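import Literature.NumberTheory.EllipticCurves.IsogenyTwoTorsionProofs
import Literature.NumberTheory.EllipticCurves.IsogenyVariableChangeProofs
import Literature.NumberTheory.EllipticCurves.IsogenyCompProofs
import Literature.NumberTheory.DiophantineGeometry.GeneralizedFermatTwoPowerCoefficientFreyProofs
import Literature.NumberTheory.DiophantineGeometry.MinimalDiscriminantFactorizationProofs
import Literature.NumberTheory.EllipticCurves.IntegralModelMinimalScalingProofs
import HarnessLib

/-!
# The curve `2`-isogenous to a Frey–Hellegouarch curve: `Δ_min(E') = 2^{8−12m} |αβ| (α+β)⁴`, `m ≤ 3`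
# (von Känel–Matschke 2016/2023, proof of Lemma 10.5)

Topic `Literature/NumberTheory/EllipticCurves` (family `abc`, LADDER-ABC A1: the *modular method*).
A proofs-only file (theorems only; NO definition, NO new named fact, nothing restated; D-0026)
serving the discharge of the named fact
`Literature.NumberTheory.EllipticCurves.ModularForms.vonKanelMatschke_lemma_10_5`
(`SUnitMordellCurveConstructions.lean`; R. von Känel, B. Matschke, arXiv:1605.06079 = Mem. AMS
**286** (2023) no. 1419 [`VonkanelMatschke2023`], Lemma 10.5 = `lem:psu2`). This file proves the
second half of the printed proof (arXiv p. 59–60), about the curve `E'`: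

*"we obtain that `E` is `ℚ`-isogenous to the elliptic curve `E'` over `ℚ`, which is defined by the
Weierstrass equation (see for example [Silverman, AEC]) `w² = z³ − 2(β − α)z² + γ²z` with
discriminant `Δ' = −2⁸αβγ⁴`. This Weierstrass equation has associated quantities
`c₄ = 16(α² − 14αβ + β²)` and `c₆ = 64(α³ + 33α²β − 33αβ² − β³)`. … An application of the
Euclidean algorithm gives the identities
`4(395α² − 430αβ − 13β²)c₄ + (181α − 13β)c₆ = 2¹²3²α⁴`,
`4(−13α² − 430αβ + 395β²)c₄ + (13α − 181β)c₆ = 2¹²3²β⁴`.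
On using that `Δ', c₄, c₆ ∈ ℤ` and that `Δ_{E'}` is the absolute value of the discriminant of a
minimal Weierstrass model of `E'` over `ℤ`, we obtain `u ∈ ℤ` such that `u¹²Δ_{E'} = ±Δ'`,
`u⁴ ∣ c₄` and `u⁶ ∣ c₆`. Thus the displayed identities together with `(α, β) = 1` imply that
`u⁴ ∣ 2¹²3²` and hence `±u ∈ {1, 2, 4, 8}`. We deduce that `Δ_{E'} = 2^{8−12m}|ab|c⁴` with
`m ∈ {0, 1, 2, 3}`"* (here `γ = α + β`).

In the tree `E = freyCurve α β : y² = x(x − α)(x + β)` (`EllipticCurves/Szpiro`) is in two-torsion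
normal form `⟨0, β − α, 0, −αβ, 0⟩` and `E'` **is** Silverman's explicit `2`-isogenous curve
`(freyCurve α β).twoIsogenyCodomain = ⟨0, −2(β − α), 0, (β − α)² + 4αβ, 0⟩` of
`IsogenyTwoTorsionProofs` (AEC III.4.5; `isIsogenous_twoIsogenyCodomain`, a term of the prelude's
`Isogeny`, PROVED there). Contents:

1. The local form of "`u¹²Δ_min = ±Δ`, `u⁴ ∣ c₄`, `u⁶ ∣ c₆`" for an integral equation over `ℤ`
   is `exists_ordMinimalDiscriminant_add_eq_padicValInt` (`IntegralModelMinimalScalingProofs`,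
   Silverman AEC VII.1).
2. The integral model `⟨0, −2(β − α), 0, (α + β)², 0⟩` of `E'`, its `c₄`, `c₆`, `Δ` (as printed) and
   the two Euclidean identities (`ring`); minimality at every odd prime for `α, β` coprime
   (`p ∣ αβ(α+β) ⇒ p ∤ c₄`); the `2`-adic bound `k ≤ 3`.
3. `exists_two_pow_mul_minimalDiscriminantNorm_twoIsogenyCodomain_freyCurve` —
   **`2^{12m} Δ_min(E') = 2⁸ |αβ| |α + β|⁴` for some `m ≤ 3`**, and the isogeny statements
   `isIsogenous_freyCurve_twoIsogenyCodomain` (`E ~ E'`).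

No `abc` claim; typed ≠ endorsed. All theorems; axioms standard.

## References

* R. von Känel, B. Matschke, arXiv:1605.06079 (2016) = Mem. AMS 286 (2023), Lemma 10.5 and its
  proof, §10.4 (arXiv numbering). [VonkanelMatschke2023]
* J. H. Silverman, *The Arithmetic of Elliptic Curves*, 2nd ed., III.4 Example 4.5 (the
  `2`-isogeny), VII.1 (minimal equations, Prop. 1.3), VIII.8 (minimal discriminant). [SilvermanAEC2009]
-/

noncomputable section

open IsDedekindDomain WeierstrassCurve Rat.HeightOneSpectrum

namespace Literature.NumberTheory.EllipticCurves


/-! ### 2. The curve `E' : w² = z³ − 2(β − α)z² + (α + β)²z` and its integral model -/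

section TwoIsogenous

variable (α β : ℤ)

/-- The Frey curve `y² = x(x − α)(x + β)` is in two-torsion normal form `⟨0, β − α, 0, −αβ, 0⟩`
(Silverman AEC III.4.5's `E₁ : y² = x³ + ax² + bx` with `a = β − α`, `b = −αβ`). Stated as a
theorem (used via `haveI`) to keep this file free of instances.
[cite: SilvermanAEC2009, III.4 Example 4.5] -/
theorem isTwoTorsionNF_freyCurve : (freyCurve α β).IsTwoTorsionNF := ⟨rfl, rfl, rfl⟩

/-- **`E'` is the base change of the integral equation `w² = z³ − 2(β − α)z² + (α + β)²z`**
(`a² − 4b = (β − α)² + 4αβ = (α + β)²`): vKM, proof of Lemma 10.5, "`w² = z³ − 2(β − α)z² + γ²z`".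
[cite: VonkanelMatschke2023, Lemma 10.5 (proof, arXiv §10.4 p. 59)] -/
theorem twoIsogenyCodomain_freyCurve_eq_baseChange :
    (freyCurve α β).twoIsogenyCodomain =
      (⟨0, -(2 * (β - α)), 0, (α + β) ^ 2, 0⟩ : WeierstrassCurve ℤ).baseChange ℚ := by
  ext
  · simp [twoIsogenyCodomain, baseChange]
  · simp only [twoIsogenyCodomain_a₂, freyCurve_a₂, baseChange, map_a₂, eq_intCast, Int.cast_neg,
      Int.cast_mul, Int.cast_sub, Int.cast_ofNat]
    ring
  · simp [twoIsogenyCodomain, baseChange]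
  · simp only [twoIsogenyCodomain_a₄, freyCurve_a₂, freyCurve_a₄, baseChange, map_a₄, eq_intCast,
      Int.cast_pow, Int.cast_add]
    ring
  · simp [twoIsogenyCodomain, baseChange]

/-- `c₄(E') = 16(α² − 14αβ + β²)` (vKM, proof of Lemma 10.5, "associated quantities").
[cite: VonkanelMatschke2023, Lemma 10.5 (proof, arXiv §10.4 p. 59)] -/
theorem twoIsogenousModel_c₄ :
    (⟨0, -(2 * (β - α)), 0, (α + β) ^ 2, 0⟩ : WeierstrassCurve ℤ).c₄ =
      16 * (α ^ 2 - 14 * α * β + β ^ 2) := by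
  simp only [WeierstrassCurve.c₄, WeierstrassCurve.b₂, WeierstrassCurve.b₄]; ring

/-- `c₆(E') = 64(α³ + 33α²β − 33αβ² − β³)` (vKM, proof of Lemma 10.5).
[cite: VonkanelMatschke2023, Lemma 10.5 (proof, arXiv §10.4 p. 59)] -/
theorem twoIsogenousModel_c₆ :
    (⟨0, -(2 * (β - α)), 0, (α + β) ^ 2, 0⟩ : WeierstrassCurve ℤ).c₆ =
      64 * (α ^ 3 + 33 * α ^ 2 * β - 33 * α * β ^ 2 - β ^ 3) := by
  simp only [WeierstrassCurve.c₆, WeierstrassCurve.b₂, WeierstrassCurve.b₄, WeierstrassCurve.b₆]; ring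

/-- `Δ(E') = −2⁸αβ(α + β)⁴` (vKM, proof of Lemma 10.5: "with discriminant `Δ' = −2⁸αβγ⁴`").
[cite: VonkanelMatschke2023, Lemma 10.5 (proof, arXiv §10.4 p. 59)] -/
theorem twoIsogenousModel_Δ :
    (⟨0, -(2 * (β - α)), 0, (α + β) ^ 2, 0⟩ : WeierstrassCurve ℤ).Δ =
      -(2 ^ 8 * (α * β * (α + β) ^ 4)) := by
  simp only [WeierstrassCurve.Δ, WeierstrassCurve.b₂, WeierstrassCurve.b₄, WeierstrassCurve.b₆,
    WeierstrassCurve.b₈]; ring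

/-- **The first Euclidean identity** of the printed proof:
`4(395α² − 430αβ − 13β²)c₄ + (181α − 13β)c₆ = 2¹²3²α⁴`.
[cite: VonkanelMatschke2023, Lemma 10.5 (proof, arXiv §10.4 p. 60, first display)] -/
theorem euclid_identity_fst :
    4 * (395 * α ^ 2 - 430 * α * β - 13 * β ^ 2) * (16 * (α ^ 2 - 14 * α * β + β ^ 2)) +
      (181 * α - 13 * β) * (64 * (α ^ 3 + 33 * α ^ 2 * β - 33 * α * β ^ 2 - β ^ 3)) =
        2 ^ 12 * 3 ^ 2 * α ^ 4 := by
  ring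

/-- **The second Euclidean identity** of the printed proof:
`4(−13α² − 430αβ + 395β²)c₄ + (13α − 181β)c₆ = 2¹²3²β⁴`.
[cite: VonkanelMatschke2023, Lemma 10.5 (proof, arXiv §10.4 p. 60, first display)] -/
theorem euclid_identity_snd :
    4 * (-13 * α ^ 2 - 430 * α * β + 395 * β ^ 2) * (16 * (α ^ 2 - 14 * α * β + β ^ 2)) +
      (13 * α - 181 * β) * (64 * (α ^ 3 + 33 * α ^ 2 * β - 33 * α * β ^ 2 - β ^ 3)) =
        2 ^ 12 * 3 ^ 2 * β ^ 4 := by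
  ring

variable {α β}

/-- `E'` is an elliptic curve when `αβ(α + β) ≠ 0` (vKM: "the elliptic curve `E'` over `ℚ`";
`Δ' = −2⁸αβ(α+β)⁴ ≠ 0`). [cite: VonkanelMatschke2023, Lemma 10.5 (proof, arXiv §10.4 p. 59)] -/
theorem isElliptic_twoIsogenyCodomain_freyCurve (h0 : α * β * (α + β) ≠ 0) :
    (freyCurve α β).twoIsogenyCodomain.IsElliptic := by
  haveI := isElliptic_freyCurve h0
  haveI := isTwoTorsionNF_freyCurve α β
  infer_instance

/-- The integral equation `w² = z³ − 2(β − α)z² + (α + β)²z` of `E'` defines an elliptic curve over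
`ℚ` when `αβ(α + β) ≠ 0`. [cite: VonkanelMatschke2023, Lemma 10.5 (proof, arXiv §10.4 p. 59)] -/
theorem isElliptic_twoIsogenousModel_baseChange (h0 : α * β * (α + β) ≠ 0) :
    ((⟨0, -(2 * (β - α)), 0, (α + β) ^ 2, 0⟩ : WeierstrassCurve ℤ).baseChange ℚ).IsElliptic := by
  rw [← twoIsogenyCodomain_freyCurve_eq_baseChange]; exact isElliptic_twoIsogenyCodomain_freyCurve h0

/-- **`E ~ E'` over `ℚ`**: the Frey curve `y² = x(x − α)(x + β)` (`αβ(α+β) ≠ 0`) is isogenous to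
`w² = z³ − 2(β − α)z² + (α + β)²z` — Silverman's explicit `2`-isogeny (AEC III.4.5; the tree's
`isIsogenous_twoIsogenyCodomain`, a term of the prelude structure `Isogeny`); vKM: "we obtain that
`E` is `ℚ`-isogenous to the elliptic curve `E'`". [cite: VonkanelMatschke2023, Lemma 10.5 (proof)]
[cite: SilvermanAEC2009, III.4 Example 4.5] -/
theorem isIsogenous_freyCurve_twoIsogenyCodomain (h0 : α * β * (α + β) ≠ 0) :
    IsIsogenous (freyCurve α β) (freyCurve α β).twoIsogenyCodomain := by
  haveI := isElliptic_freyCurve h0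
  haveI := isTwoTorsionNF_freyCurve α β
  exact isIsogenous_twoIsogenyCodomain _

/-- An odd prime dividing `αβ(α + β)` (`α, β` coprime) does not divide `α² − 14αβ + β²`
(`= α(α − 14β) + β² = β(β − 14α) + α² = (α + β)² − 16αβ`). [folklore] -/
private theorem not_dvd_c₄_factor (hαβ : IsCoprime α β) {p : ℕ} (hp : p.Prime) (hp2 : p ≠ 2)
    (hpm : (p : ℤ) ∣ α * β * (α + β)) : ¬ (p : ℤ) ∣ α ^ 2 - 14 * α * β + β ^ 2 := by
  have hpint : Prime (p : ℤ) := Nat.prime_iff_prime_int.mp hp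
  have hnot : ¬ ((p : ℤ) ∣ α ∧ (p : ℤ) ∣ β) := fun ⟨ha, hb⟩ ↦ by
    have h := Int.isUnit_iff.mp (hαβ.isUnit_of_dvd' ha hb)
    have hp1 : (1 : ℤ) < (p : ℤ) := by exact_mod_cast hp.one_lt
    omega
  intro hc
  rcases hpint.dvd_or_dvd hpm with hab | hc'
  · rcases hpint.dvd_or_dvd hab with ha | hb
    · have : (p : ℤ) ∣ β ^ 2 := by
        have e : β ^ 2 = (α ^ 2 - 14 * α * β + β ^ 2) - α * (α - 14 * β) := by ring
        rw [e]; exact dvd_sub hc (dvd_mul_of_dvd_left ha _)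
      exact hnot ⟨ha, hpint.dvd_of_dvd_pow this⟩
    · have : (p : ℤ) ∣ α ^ 2 := by
        have e : α ^ 2 = (α ^ 2 - 14 * α * β + β ^ 2) - β * (β - 14 * α) := by ring
        rw [e]; exact dvd_sub hc (dvd_mul_of_dvd_left hb _)
      exact hnot ⟨hpint.dvd_of_dvd_pow this, hb⟩
  · have h16 : (p : ℤ) ∣ 16 * (α * β) := by
      have e : 16 * (α * β) = (α + β) ^ 2 - (α ^ 2 - 14 * α * β + β ^ 2) := by ring
      rw [e]; exact dvd_sub (dvd_pow hc' two_ne_zero) hc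
    rcases hpint.dvd_or_dvd h16 with h | h
    · exact hp2 (eq_two_of_dvd_sixteen hp h)
    · have key : (p : ℤ) ∣ α ∧ (p : ℤ) ∣ β := by
        rcases hpint.dvd_or_dvd h with ha | hb
        · exact ⟨ha, by simpa using dvd_sub hc' ha⟩
        · exact ⟨by simpa using dvd_sub hc' hb, hb⟩
      exact hnot key

/-- **`E'` is minimal at every odd prime** (`α, β` coprime, `αβ(α+β) ≠ 0`): an odd `p ∣ αβ(α+β)`
does not divide `c₄ = 16(α² − 14αβ + β²)`, and an odd `p ∤ αβ(α+β)` does not divide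
`Δ = −2⁸αβ(α+β)⁴` (Silverman AEC VII.1 Remark 1.1). [cite: SilvermanAEC2009, VII.1 Remark 1.1] -/
theorem isMinimalAt_twoIsogenousModel_of_ne_two (hαβ : IsCoprime α β)
    (v : HeightOneSpectrum ℤ) (hv : natGenerator v ≠ 2) :
    ((⟨0, -(2 * (β - α)), 0, (α + β) ^ 2, 0⟩ : WeierstrassCurve ℤ).baseChange ℚ).IsMinimalAt v := by
  set p := natGenerator v with hp
  have hpp : p.Prime := prime_natGenerator v
  have hpint : Prime (p : ℤ) := Nat.prime_iff_prime_int.mp hpp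
  by_cases hpm : (p : ℤ) ∣ α * β * (α + β)
  · refine isMinimalAt_baseChange_int_of_not_dvd_c₄ ?_
    rw [← hp, twoIsogenousModel_c₄]
    intro hc
    rcases hpint.dvd_or_dvd hc with hc | hc
    · exact hv (eq_two_of_dvd_sixteen hpp hc)
    · exact not_dvd_c₄_factor hαβ hpp hv hpm hc
  · refine isMinimalAt_baseChange_int_of_not_pow_dvd_Δ ?_
    rw [← hp, twoIsogenousModel_Δ]
    intro h
    have h1 : (p : ℤ) ∣ 2 ^ 8 * (α * β * (α + β) ^ 4) :=
      dvd_neg.mp (dvd_trans (dvd_pow_self _ (by norm_num)) h)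
    rcases hpint.dvd_or_dvd h1 with h2 | h2
    · have : (p : ℤ) ∣ 16 := (hpint.dvd_of_dvd_pow h2).trans ⟨8, by norm_num⟩
      exact hv (eq_two_of_dvd_sixteen hpp this)
    · apply hpm
      rcases hpint.dvd_or_dvd h2 with h3 | h3
      · exact dvd_mul_of_dvd_left h3 _
      · exact dvd_mul_of_dvd_right (hpint.dvd_of_dvd_pow h3) _

/-- **`ord_p Δ_min(E') = ord_p(2⁸αβ(α+β)⁴)` at every odd prime `p`** (the model is minimal there).
[cite: SilvermanAEC2009, VII.1 Prop. 1.3] -/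
theorem ordMinimalDiscriminant_twoIsogenyCodomain_freyCurve_of_ne_two (hαβ : IsCoprime α β)
    (h0 : α * β * (α + β) ≠ 0) (v : HeightOneSpectrum ℤ) (hv : natGenerator v ≠ 2) :
    (freyCurve α β).twoIsogenyCodomain.ordMinimalDiscriminant v =
      padicValInt (natGenerator v) (2 ^ 8 * (α * β * (α + β) ^ 4)) := by
  haveI := isElliptic_twoIsogenousModel_baseChange h0
  rw [twoIsogenyCodomain_freyCurve_eq_baseChange,
    Literature.NumberTheory.DiophantineGeometry.ordMinimalDiscriminant_eq_padicValInt_of_isMinimalAt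
      (isMinimalAt_twoIsogenousModel_of_ne_two hαβ v hv),
    twoIsogenousModel_Δ, Literature.NumberTheory.DiophantineGeometry.padicValInt_neg]

/-- Coprime integers are not both even. [folklore] -/
private theorem not_two_dvd_both (hαβ : IsCoprime α β) : ¬ ((2 : ℤ) ∣ α ∧ (2 : ℤ) ∣ β) := by
  rintro ⟨ha, hb⟩
  have h := Int.isUnit_iff.mp (hαβ.isUnit_of_dvd' ha hb)
  omega

/-- `2 ^ n ∣ 2¹² · 9 · x⁴` with `x` odd forces `n ≤ 12`. [folklore] -/
private theorem le_twelve_of_pow_dvd {x : ℤ} (hx : ¬ (2 : ℤ) ∣ x) {n : ℕ}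
    (h : (2 : ℤ) ^ n ∣ 2 ^ 12 * 3 ^ 2 * x ^ 4) : n ≤ 12 := by
  haveI : Fact (Nat.Prime 2) := ⟨Nat.prime_two⟩
  have hx0 : x ≠ 0 := by rintro rfl; exact hx (dvd_zero _)
  have h2 : padicValInt 2 (2 : ℤ) = 1 := by exact_mod_cast padicValInt.self (p := 2) one_lt_two
  have h3 : padicValInt 2 (3 : ℤ) = 0 := padicValInt.eq_zero_of_not_dvd (by omega)
  have hxv : padicValInt 2 x = 0 := padicValInt.eq_zero_of_not_dvd (by exact_mod_cast hx)
  have hval : padicValInt 2 ((2 : ℤ) ^ 12 * 3 ^ 2 * x ^ 4) = 12 := by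
    rw [padicValInt.mul (by positivity) (pow_ne_zero 4 hx0),
      padicValInt.mul (by positivity) (by positivity),
      Literature.NumberTheory.DiophantineGeometry.padicValInt_pow,
      Literature.NumberTheory.DiophantineGeometry.padicValInt_pow,
      Literature.NumberTheory.DiophantineGeometry.padicValInt_pow, h2, h3, hxv]
  have h' : ((2 : ℕ) : ℤ) ^ n ∣ 2 ^ 12 * 3 ^ 2 * x ^ 4 := by exact_mod_cast h
  rcases (padicValInt_dvd_iff _ _).mp h' with h1 | h1
  · exact absurd h1 (by positivity)
  · rwa [hval] at h1

/-- **The `2`-adic step: `ord₂ Δ_min(E') + 12m = ord₂(2⁸αβ(α+β)⁴)` with `m ≤ 3`** (`α, β` coprime):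
the scaling order `m` of `exists_ordMinimalDiscriminant_add_eq_padicValInt` has `2^{4m} ∣ c₄`,
`2^{4m} ∣ c₆`, hence `2^{4m}` divides `2¹²3²α⁴` and `2¹²3²β⁴` by the two Euclidean identities, and one
of `α, β` is odd — the printed "`u⁴ ∣ 2¹²3²` and hence `±u ∈ {1, 2, 4, 8}`".
[cite: VonkanelMatschke2023, Lemma 10.5 (proof, arXiv §10.4 p. 60)] -/
theorem exists_ordMinimalDiscriminant_twoIsogenyCodomain_freyCurve_two (hαβ : IsCoprime α β)
    (h0 : α * β * (α + β) ≠ 0) (v : HeightOneSpectrum ℤ) (hv : natGenerator v = 2) :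
    ∃ m : ℕ, m ≤ 3 ∧ (freyCurve α β).twoIsogenyCodomain.ordMinimalDiscriminant v + 12 * m =
      padicValInt 2 (2 ^ 8 * (α * β * (α + β) ^ 4)) := by
  haveI := isElliptic_twoIsogenousModel_baseChange h0
  obtain ⟨k, hk, hc₄, hc₆⟩ := exists_ordMinimalDiscriminant_add_eq_padicValInt v
    (⟨0, -(2 * (β - α)), 0, (α + β) ^ 2, 0⟩ : WeierstrassCurve ℤ)
  rw [hv] at hk hc₄ hc₆
  rw [twoIsogenousModel_c₄] at hc₄
  rw [twoIsogenousModel_c₆] at hc₆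
  rw [twoIsogenousModel_Δ, Literature.NumberTheory.DiophantineGeometry.padicValInt_neg] at hk
  push_cast at hc₄ hc₆ hk
  have hc₆' : (2 : ℤ) ^ (4 * k) ∣ 64 * (α ^ 3 + 33 * α ^ 2 * β - 33 * α * β ^ 2 - β ^ 3) :=
    (pow_dvd_pow 2 (by omega)).trans hc₆
  have hα : (2 : ℤ) ^ (4 * k) ∣ 2 ^ 12 * 3 ^ 2 * α ^ 4 := by
    rw [← euclid_identity_fst]
    exact dvd_add (dvd_mul_of_dvd_right hc₄ _) (dvd_mul_of_dvd_right hc₆' _)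
  have hβ : (2 : ℤ) ^ (4 * k) ∣ 2 ^ 12 * 3 ^ 2 * β ^ 4 := by
    rw [← euclid_identity_snd]
    exact dvd_add (dvd_mul_of_dvd_right hc₄ _) (dvd_mul_of_dvd_right hc₆' _)
  have hk3 : k ≤ 3 := by
    by_cases ha : (2 : ℤ) ∣ α
    · have hb : ¬ (2 : ℤ) ∣ β := fun hb ↦ not_two_dvd_both hαβ ⟨ha, hb⟩
      have := le_twelve_of_pow_dvd hb hβ
      omega
    · have := le_twelve_of_pow_dvd ha hα
      omega
  refine ⟨k, hk3, ?_⟩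
  rw [twoIsogenyCodomain_freyCurve_eq_baseChange]
  exact hk

/-- `|−2⁸αβ(α+β)⁴| = 2⁸ |αβ| |α+β|⁴` in `ℕ`. [folklore] -/
private theorem natAbs_disc (α β : ℤ) :
    (2 ^ 8 * (α * β * (α + β) ^ 4)).natAbs = 2 ^ 8 * (α * β).natAbs * (α + β).natAbs ^ 4 := by
  rw [Int.natAbs_mul, Int.natAbs_mul, Int.natAbs_pow, Int.natAbs_pow]
  simp [mul_assoc]

/-- **`Δ_{E'} = 2^{8−12m}|αβ|(α+β)⁴` with `m ∈ {0, 1, 2, 3}`** for the curve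
`E' : w² = z³ − 2(β − α)z² + (α + β)²z` `2`-isogenous to the Frey curve `y² = x(x − α)(x + β)`
(`α, β` coprime, `αβ(α+β) ≠ 0`), written multiplicatively in `ℕ`:
`2^{12m} · Δ_min(E') = 2⁸ · |αβ| · |α + β|⁴`. This is the `E'`-half of vKM Lemma 10.5 (with
`{|α|, |β|} = {|a|, |b|}`, `|α + β| = |c|`). Proof: prime by prime — at odd `p` the integral model is
minimal, at `2` the scaling order is `m ≤ 3` (`exists_ordMinimalDiscriminant_twoIsogenyCodomain_freyCurve_two`).
[cite: VonkanelMatschke2023, Lemma 10.5 (arXiv §10.4, lem:psu2) and its proof p. 59–60] -/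
theorem exists_two_pow_mul_minimalDiscriminantNorm_twoIsogenyCodomain_freyCurve
    (hαβ : IsCoprime α β) (h0 : α * β * (α + β) ≠ 0) :
    ∃ m : ℕ, m ≤ 3 ∧ 2 ^ (12 * m) * (freyCurve α β).twoIsogenyCodomain.minimalDiscriminantNorm ℤ =
      2 ^ 8 * (α * β).natAbs * (α + β).natAbs ^ 4 := by
  set E' := (freyCurve α β).twoIsogenyCodomain with hE'
  obtain ⟨v₂, hv₂⟩ := exists_place ⟨2, Nat.prime_two⟩
  replace hv₂ : natGenerator v₂ = 2 := hv₂
  obtain ⟨m, hm3, hm⟩ := exists_ordMinimalDiscriminant_twoIsogenyCodomain_freyCurve_two hαβ h0 v₂ hv₂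
  refine ⟨m, hm3, ?_⟩
  have hD0 : 2 ^ 8 * (α * β * (α + β) ^ 4) ≠ 0 := by
    have hα : α ≠ 0 := fun h ↦ h0 (by rw [h]; ring)
    have hβ : β ≠ 0 := fun h ↦ h0 (by rw [h]; ring)
    have hγ : α + β ≠ 0 := fun h ↦ h0 (by rw [h]; ring)
    positivity
  rw [← natAbs_disc]
  apply Nat.eq_of_factorization_eq
  · exact mul_ne_zero (pow_ne_zero _ two_ne_zero) (minimalDiscriminantNorm_pos_holds E').ne'
  · exact Int.natAbs_ne_zero.mpr hD0
  intro p
  by_cases hp : p.Prime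
  · obtain ⟨v, hv⟩ := exists_place ⟨p, hp⟩
    replace hv : natGenerator v = p := hv
    rw [Nat.factorization_mul (pow_ne_zero _ two_ne_zero) (minimalDiscriminantNorm_pos_holds E').ne',
      Finsupp.add_apply, ← hv, factorization_minimalDiscriminantNorm_holds E' v, hv,
      Nat.factorization_def _ hp, Nat.factorization_def _ hp]
    change _ = padicValInt p (2 ^ 8 * (α * β * (α + β) ^ 4))
    by_cases hp2 : p = 2
    · subst hp2
      have hvv : v = v₂ := by
        apply (primesEquiv (R := ℤ)).injective
        exact Subtype.ext (hv.trans hv₂.symm)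
      subst hvv
      rw [padicValNat.prime_pow, ← hm]
      ring
    · haveI : Fact p.Prime := ⟨hp⟩
      rw [padicValNat.eq_zero_of_not_dvd (fun h ↦ hp2 ?_), zero_add, ← hv,
        ordMinimalDiscriminant_twoIsogenyCodomain_freyCurve_of_ne_two hαβ h0 v (hv ▸ hp2)]
      exact (Nat.prime_dvd_prime_iff_eq hp Nat.prime_two).mp (hp.dvd_of_dvd_pow h)
  · rw [Nat.factorization_eq_zero_of_not_prime _ hp, Nat.factorization_eq_zero_of_not_prime _ hp]

end TwoIsogenous

end Literature.NumberTheory.EllipticCurves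

end
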